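import Literature.IUT.HodgeTheaters.GoodLocalFrobenioidOfPlaceCdashSplit
import HarnessLib

/-!
# [IUTchI] Example 3.3 (iii) — ALL FIVE clauses (a)–(e) in ONE call, AT THE FINITE PLACE `v̲ = w ∣ p` of `K`

S. Mochizuki, *Inter-universal Teichmüller theory I*, §3, Example 3.3 (iii), kurims final manuscript (May 2020) p. 79 l. 32–62 [claim:
Mochizuki2012, status: disputed], verbatim (our ellipses marked «[…]»; underlines `F̲_v` restored by hand): "(iii) Here, it is useful to recall
that (a) the subcategory `D⊢_v ⊆ D_v` may be reconstructed category-theoretically from `D_v` [cf. [AbsAnab], Lemma 1.3.8]; (b) the category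
`D⊢_v` (respectively, `D^Θ_v`) may be reconstructed category-theoretically from `C⊢_v` (respectively, `C^Θ_v`) [cf. [FrdI], Theorem 3.4, (v);
[FrdII], Theorem 1.2, (i); [FrdII], Example 1.3, (i); [AbsAnab], Theorem 1.1.1, (ii)]; (c) the category `D_v` may be reconstructed
category-theoretically from `F̲_v = C_v` [cf. [FrdI], Theorem 3.4, (v); [FrdII], Theorem 1.2, (i); [FrdII], Example 1.3, (i); [AbsAnab], Lemma
1.3.1].  Note that it follows immediately from the category-theoreticity of the divisor monoid `Φ_{C_v}` [cf. [FrdI], Corollary 4.11, (iii);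
[FrdII], Theorem 1.2, (i)], together with (a), (c), and the definition of `C⊢_v` [cf. also [AbsAnab], Proposition 1.2.1, (v)], that (d) `C⊢_v`
may be reconstructed category-theoretically from `F̲_v`.  Finally, by applying the algorithmically constructed field structure on the image of
the Kummer map of [AbsTopIII], Proposition 3.2, (iii) […], it follows that one may construct the element “`p_v`” of `O^▷_{K_v}`
category-theoretically from `F̲_v` […]. […] In particular, (e) one may reconstruct the split Frobenioids `F⊢_v`, `F^Θ_v` category-theoretically
from `F̲_v`."  Nothing of the series is asserted; no side is taken on [IUTchIII] Cor. 3.12.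

PROOF-ONLY companion (abc-iut cell, seat abc-iut-w4-d047 gen 8; DAG node `IUTchI:Ex3.3(iii)`, rows E33iii/a–e of `plan/L5/SUBDAG-IUTchI-Ex33-Ex34.md`),
0 definitions, no new Prop fact, nothing restated: every clause is consumed BY NAME from its closer of record AT THE GENUINE PLACE `v̲ = w ∣ p`
of the initial Θ-datum `D` (`K_v̲ := K_w` = abc-iut-S7's `RescaledCompletion K p w hw`, `Ω := K̄_w`, `Π_v̲ := Π_{X̲→_K} ×_{G_K} Gal(K̄_w/K_w)`
along the chosen embedding `localEmb`, object `D.goodLocalFrobenioidAt w p hw hX` of abc-iut-L5-t2's `InitialThetaDataGoodLocalFrobenioid`):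

* (a) `ddashFromD_goodLocalFrobenioidAt_of_forall_map_ker` / `…_of_coinvariantRank` (GoodLocalFrobenioidOfGaloisDdash, InitialThetaDataLocalDeltaCharacteristic);
* (b) `basesFromC_goodLocalFrobenioidAt` (GoodLocalFrobenioidOfPlaceSlim — UNCONDITIONAL given `hX`);
* (c) `dFromF_goodLocalFrobenioidAt_of_geom_slim` (InitialThetaDataLocalSlim);
* (d) `cdashFromF_goodLocalFrobenioidAt` / `…_of_coinvariantRank` (GoodLocalFrobenioidOfPlaceCdashSplit);
* (e) `splitFromF_goodLocalFrobenioidAt_of_conj_autCongr` / `…_of_coinvariantRank` (GoodLocalFrobenioidOfPlaceCdashSplit).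

RESULT.  The node's typed content — the FIVE-FOLD CONJUNCTION `DdashFromD ∧ BasesFromC ∧ DFromF ∧ CdashFromF ∧ SplitFromF`,
i.e. exactly the shape of abc-iut-L5-t2's interface certificate `GoodLocalFrobenioid.exists_ex33Claims` (toy `K_v := ℚ_p`)
and of the conjunction REFUTED at the degenerate real [FrdII] instance `ofKitQp p`
(`GoodLocalFrobenioid.ex33iii_abcd_not_e_ofKitQp`: (a)(b)(c)(d) hold, (e) fails over the one-point base) — is ONE
kernel theorem at the genuine place, in three regimes:

* `ex33iii_goodLocalFrobenioidAt_of_conj_autCongr` — displayed binders EXACTLY {Galois-countability instance on `Π_{C_F}`,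
  `hX` (Def. 3.1 (f) openness), `hΔC` = FACT F-0004 first conjunct ([AbsAnab] Lem. 1.3.1, tree shape
  `IsSlimGroup D.DeltaC`), `hΔ` = FACT F-0007 `PreservesGeom` in unfolded local shape ([AbsAnab] Lem. 1.3.8), DATA
  `e : K̄_w ≃ₐ[ℚ_p] ℚ̄_p`, `hconj` = GAP-LEDGER G-L5t16g8-1 ([AbsTopIII] Thm. 1.9 / Cor. 1.10 (iii), Galois side,
  printed strength — a HYPOTHESIS)};
* `…_of_geomTFG` — the instance supplied by FACT F-0240 `GeomTFG` ([AbsTopI] Prop. 2.2) BY NAME;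
* `…_of_coinvariantRank` — `hΔ` REPLACED by print's regime input F-0001 `CoinvariantRankConstant` in unfolded shape
  ([AbsTopI] Thm. 2.6 (ii)), through abc-iut-f-052's `forall_map_ker_augLoc_of_coinvariantRank`.

And the (E2)-FREE part: `ex33iii_abcd_goodLocalFrobenioidAt[_of_geomTFG|_of_coinvariantRank]` — clauses (a)(b)(c)(d)
jointly, modulo FROZEN FACT-LIST rows (F-0240, F-0004, F-0007 | F-0001) and `hX` ONLY; so the GAP hypothesis `hconj`
enters the node through clause (e) alone — the same clause that FAILS at `ofKitQp` (the anabelian input is load-bearing).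
Finally `exists_ex33Claims_at_place[_of_geomTFG]` is the genuine-place twin of `exists_ex33Claims` (the interface over
the ACTUAL completion `K_v̲` inhabited TOGETHER WITH all five clauses, witness = the datum's own `goodLocalFrobenioidAt`).

Honest framing: typed ≠ proved for the displayed inputs; «closed modulo `hconj`» ≠ discharged; the FACT rows are
consumed by name / in printed shape and never discharged here; nothing asserts abc proved or refuted.
-/

noncomputable section

namespace Literature.IUT.HodgeTheaters

open CategoryTheory Literature.AnabelianGeometry.SemiGraphs Literature.AlgebraicGeometry.Frobenioids
open Literature.AlgebraicGeometry.Frobenioids.PadicFrd Literature.AnabelianGeometry.AbsoluteAnabelian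
open Literature.NumberTheory.NumberFields IsDedekindDomain NumberField

universe u

section Place

variable {F : Type u} {K : Type} {Fbar : Type} [Field F] [NumberField F] [Field K] [NumberField K]
  [Algebra F K] [Field Fbar] [Algebra F Fbar] [Algebra K Fbar] [IsScalarTower F K Fbar] [Normal K Fbar]
  {E : WeierstrassCurve F} [E.IsElliptic] {l : ℕ} {Pb : BadPlacePredicates K}
  (D : InitialThetaData F K Fbar E l Pb) (w : HeightOneSpectrum (𝓞 K)) (p : ℕ) [Fact p.Prime]
  (hw : ((p : ℕ) : 𝓞 K) ∈ w.asIdeal)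

namespace InitialThetaData

/-! ### (a)(b)(c)(d) jointly — (E2)-free, frozen FACT rows + `hX` only -/

/-- **[IUTchI] Ex. 3.3 (iii) (a)∧(b)∧(c)∧(d) for `D` AT THE FINITE PLACE `v̲ = w ∣ p` of `K`** (`K_v̲ := K_w`,
`Ω := K̄_w`, `Π_v̲ := Π_{X̲→_K} ×_{G_K} Gal(K̄_w/K_w)`), GIVEN the Galois-countability of `Π_{C_F}`, the datum's
openness `hX` (Def. 3.1 (f)), `Δ_C` slim (FACT F-0004, first conjunct) and [AbsAnab] Lem. 1.3.8 in the shape `hΔ`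
(FACT F-0007).  No GAP hypothesis: the anabelian input (E2) enters Ex. 3.3 (iii) through clause (e) only.
([IUTchI] Ex 3.3 (iii) (a)–(d) p.79) [claim: Mochizuki2012, status: disputed] -/
theorem ex33iii_abcd_goodLocalFrobenioidAt [SecondCountableTopology D.PiC]
    (hX : IsOpen (D.PiXarrow : Set D.PiC)) (hΔC : IsSlimGroup D.DeltaC)
    (hΔ : letI : Algebra K (RescaledCompletion K p w hw) := inferInstanceAs (Algebra K (w.adicCompletion K))
      ∀ φ : D.PiLoc D.PiXarrow (localToGF F (RescaledCompletion K p w hw)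
          (localEmb (K := K) (Fbar := Fbar) (AlgebraicClosure (RescaledCompletion K p w hw)))) ≃ₜ*
        D.PiLoc D.PiXarrow (localToGF F (RescaledCompletion K p w hw)
          (localEmb (K := K) (Fbar := Fbar) (AlgebraicClosure (RescaledCompletion K p w hw)))),
      (D.augLoc D.PiXarrow (localToGF F (RescaledCompletion K p w hw)
          (localEmb (K := K) (Fbar := Fbar) (AlgebraicClosure (RescaledCompletion K p w hw))))).ker.map
          φ.toMulEquiv.toMonoidHom =
        (D.augLoc D.PiXarrow (localToGF F (RescaledCompletion K p w hw)
          (localEmb (K := K) (Fbar := Fbar) (AlgebraicClosure (RescaledCompletion K p w hw))))).ker) :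
    @GoodLocalFrobenioid.DdashFromD p (RescaledCompletion K p w hw) _
        (GaloisValDatum.normVal (RescaledCompletion K p w hw)) (D.goodLocalFrobenioidAt w p hw hX) ∧
      @GoodLocalFrobenioid.BasesFromC p (RescaledCompletion K p w hw) _
        (GaloisValDatum.normVal (RescaledCompletion K p w hw)) (D.goodLocalFrobenioidAt w p hw hX) ∧
      @GoodLocalFrobenioid.DFromF p (RescaledCompletion K p w hw) _
        (GaloisValDatum.normVal (RescaledCompletion K p w hw)) (D.goodLocalFrobenioidAt w p hw hX) ∧
      @GoodLocalFrobenioid.CdashFromF p (RescaledCompletion K p w hw) _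
        (GaloisValDatum.normVal (RescaledCompletion K p w hw)) (D.goodLocalFrobenioidAt w p hw hX) :=
  ⟨D.ddashFromD_goodLocalFrobenioidAt_of_forall_map_ker w p hw hX hΔ,
    D.basesFromC_goodLocalFrobenioidAt w p hw hX,
    D.dFromF_goodLocalFrobenioidAt_of_geom_slim w p hw hΔC hX,
    D.cdashFromF_goodLocalFrobenioidAt w p hw hX hΔC hΔ⟩

/-- **(a)∧(b)∧(c)∧(d) at the place, the Galois-countability instance supplied by FACT F-0240 `GeomTFG` BY NAME**
([AbsTopI] Prop. 2.2 ⇒ [IUTchI] Rmk. 2.5.3 (ii), `secondCountableTopology_PiC_of_geomTFG`): binders exactly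
{F-0240, `hX`, F-0004 (first conjunct), F-0007 (shape `hΔ`)} — FROZEN FACT-LIST rows and the Def. 3.1 (f) input only.
([IUTchI] Ex 3.3 (iii) (a)–(d) p.79) [claim: Mochizuki2012, status: disputed] -/
theorem ex33iii_abcd_goodLocalFrobenioidAt_of_geomTFG (hTFG : D.geom.extF.GeomTFG)
    (hX : IsOpen (D.PiXarrow : Set D.PiC)) (hΔC : IsSlimGroup D.DeltaC)
    (hΔ : letI : Algebra K (RescaledCompletion K p w hw) := inferInstanceAs (Algebra K (w.adicCompletion K))
      ∀ φ : D.PiLoc D.PiXarrow (localToGF F (RescaledCompletion K p w hw)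
          (localEmb (K := K) (Fbar := Fbar) (AlgebraicClosure (RescaledCompletion K p w hw)))) ≃ₜ*
        D.PiLoc D.PiXarrow (localToGF F (RescaledCompletion K p w hw)
          (localEmb (K := K) (Fbar := Fbar) (AlgebraicClosure (RescaledCompletion K p w hw)))),
      (D.augLoc D.PiXarrow (localToGF F (RescaledCompletion K p w hw)
          (localEmb (K := K) (Fbar := Fbar) (AlgebraicClosure (RescaledCompletion K p w hw))))).ker.map
          φ.toMulEquiv.toMonoidHom =
        (D.augLoc D.PiXarrow (localToGF F (RescaledCompletion K p w hw)
          (localEmb (K := K) (Fbar := Fbar) (AlgebraicClosure (RescaledCompletion K p w hw))))).ker) :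
    @GoodLocalFrobenioid.DdashFromD p (RescaledCompletion K p w hw) _
        (GaloisValDatum.normVal (RescaledCompletion K p w hw)) (D.goodLocalFrobenioidAt w p hw hX) ∧
      @GoodLocalFrobenioid.BasesFromC p (RescaledCompletion K p w hw) _
        (GaloisValDatum.normVal (RescaledCompletion K p w hw)) (D.goodLocalFrobenioidAt w p hw hX) ∧
      @GoodLocalFrobenioid.DFromF p (RescaledCompletion K p w hw) _
        (GaloisValDatum.normVal (RescaledCompletion K p w hw)) (D.goodLocalFrobenioidAt w p hw hX) ∧
      @GoodLocalFrobenioid.CdashFromF p (RescaledCompletion K p w hw) _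
        (GaloisValDatum.normVal (RescaledCompletion K p w hw)) (D.goodLocalFrobenioidAt w p hw hX) :=
  haveI := D.secondCountableTopology_PiC_of_geomTFG hTFG
  D.ex33iii_abcd_goodLocalFrobenioidAt w p hw hX hΔC hΔ

/-- **(a)∧(b)∧(c)∧(d) at the place with [AbsAnab] Lemma 1.3.8 REPLACED by print's regime input** — F-0001
`CoinvariantRankConstant` in unfolded shape at `Π_v̲` ([AbsTopI] Thm. 2.6 (ii)), through abc-iut-f-052's
`forall_map_ker_augLoc_of_coinvariantRank`; binders exactly {F-0240, `hX`, F-0004 (first conjunct), F-0001 shape}.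
([IUTchI] Ex 3.3 (iii) (a)–(d) p.79) [claim: Mochizuki2012, status: disputed] -/
theorem ex33iii_abcd_goodLocalFrobenioidAt_of_coinvariantRank (hTFG : D.geom.extF.GeomTFG)
    (hX : IsOpen (D.PiXarrow : Set D.PiC)) (hΔC : IsSlimGroup D.DeltaC)
    (hc : letI : Algebra K (RescaledCompletion K p w hw) := inferInstanceAs (Algebra K (w.adicCompletion K))
      ∀ P : Subgroup (D.PiLoc D.PiXarrow (localToGF F (RescaledCompletion K p w hw)
          (localEmb (K := K) (Fbar := Fbar) (AlgebraicClosure (RescaledCompletion K p w hw))))),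
      IsOpen (P : Set (D.PiLoc D.PiXarrow (localToGF F (RescaledCompletion K p w hw)
          (localEmb (K := K) (Fbar := Fbar) (AlgebraicClosure (RescaledCompletion K p w hw)))))) →
      ∀ (l₁ l₂ : ℕ) [Fact l₁.Prime] [Fact l₂.Prime],
        freeProlRank P l₁ - freeProlRank (P.map (D.augLoc D.PiXarrow (localToGF F (RescaledCompletion K p w hw)
          (localEmb (K := K) (Fbar := Fbar) (AlgebraicClosure (RescaledCompletion K p w hw)))))) l₁ =
          freeProlRank P l₂ - freeProlRank (P.map (D.augLoc D.PiXarrow (localToGF F (RescaledCompletion K p w hw)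
            (localEmb (K := K) (Fbar := Fbar) (AlgebraicClosure (RescaledCompletion K p w hw)))))) l₂) :
    @GoodLocalFrobenioid.DdashFromD p (RescaledCompletion K p w hw) _
        (GaloisValDatum.normVal (RescaledCompletion K p w hw)) (D.goodLocalFrobenioidAt w p hw hX) ∧
      @GoodLocalFrobenioid.BasesFromC p (RescaledCompletion K p w hw) _
        (GaloisValDatum.normVal (RescaledCompletion K p w hw)) (D.goodLocalFrobenioidAt w p hw hX) ∧
      @GoodLocalFrobenioid.DFromF p (RescaledCompletion K p w hw) _
        (GaloisValDatum.normVal (RescaledCompletion K p w hw)) (D.goodLocalFrobenioidAt w p hw hX) ∧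
      @GoodLocalFrobenioid.CdashFromF p (RescaledCompletion K p w hw) _
        (GaloisValDatum.normVal (RescaledCompletion K p w hw)) (D.goodLocalFrobenioidAt w p hw hX) := by
  letI : Algebra K (RescaledCompletion K p w hw) := inferInstanceAs (Algebra K (w.adicCompletion K))
  haveI := GaloisValDatum.finiteDimensional_rescaledCompletion K p w hw
  exact D.ex33iii_abcd_goodLocalFrobenioidAt_of_geomTFG w p hw hTFG hX hΔC
    (D.forall_map_ker_augLoc_of_coinvariantRank p (RescaledCompletion K p w hw)
      (localEmb (K := K) (Fbar := Fbar) (AlgebraicClosure (RescaledCompletion K p w hw))) hTFG hX hc)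

/-! ### (a)(b)(c)(d)(e) jointly — the node AS TYPED, modulo (E2) in conjugacy shape -/

/-- **[IUTchI] Ex. 3.3 (iii), ALL FIVE CLAUSES (a)∧(b)∧(c)∧(d)∧(e), for `D` AT THE FINITE PLACE `v̲ = w ∣ p` of `K`**
— the node `IUTchI:Ex3.3(iii)` AS TYPED (the conjunction of abc-iut-L5-t2's five Props, shape of `exists_ex33Claims`)
at the genuine object `D.goodLocalFrobenioidAt w p hw hX`, GIVEN: the Galois-countability of `Π_{C_F}`; `hX` (Def. 3.1
(f)); `hΔC` = FACT F-0004 first conjunct ([AbsAnab] Lem. 1.3.1); `hΔ` = FACT F-0007 in unfolded local shape ([AbsAnab]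
Lem. 1.3.8); the comparison DATA `e : K̄_w ≃ₐ[ℚ_p] ℚ̄_p`; and the anabelian input (E2) in CONJUGACY SHAPE `hconj` over
`G_{ℚ_p} := Aut_{ℚ_p-alg}(ℚ̄_p)` ([AbsTopIII] Thm. 1.9 / Cor. 1.10 (iii), Galois side, printed strength — GAP-LEDGER
G-L5t16g8-1, a HYPOTHESIS, not a FACT-LIST row).  At the degenerate real instance `ofKitQp p` the same conjunction is
REFUTED (`GoodLocalFrobenioid.ex33iii_abcd_not_e_ofKitQp`).  «closed modulo `hconj`» ≠ discharged.
([IUTchI] Ex 3.3 (iii) p.79) [claim: Mochizuki2012, status: disputed] -/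
theorem ex33iii_goodLocalFrobenioidAt_of_conj_autCongr [SecondCountableTopology D.PiC]
    (hX : IsOpen (D.PiXarrow : Set D.PiC)) (hΔC : IsSlimGroup D.DeltaC)
    (hΔ : letI : Algebra K (RescaledCompletion K p w hw) := inferInstanceAs (Algebra K (w.adicCompletion K))
      ∀ φ : D.PiLoc D.PiXarrow (localToGF F (RescaledCompletion K p w hw)
          (localEmb (K := K) (Fbar := Fbar) (AlgebraicClosure (RescaledCompletion K p w hw)))) ≃ₜ*
        D.PiLoc D.PiXarrow (localToGF F (RescaledCompletion K p w hw)
          (localEmb (K := K) (Fbar := Fbar) (AlgebraicClosure (RescaledCompletion K p w hw)))),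
      (D.augLoc D.PiXarrow (localToGF F (RescaledCompletion K p w hw)
          (localEmb (K := K) (Fbar := Fbar) (AlgebraicClosure (RescaledCompletion K p w hw))))).ker.map
          φ.toMulEquiv.toMonoidHom =
        (D.augLoc D.PiXarrow (localToGF F (RescaledCompletion K p w hw)
          (localEmb (K := K) (Fbar := Fbar) (AlgebraicClosure (RescaledCompletion K p w hw))))).ker)
    (e : letI : Algebra K (RescaledCompletion K p w hw) := inferInstanceAs (Algebra K (w.adicCompletion K))
      AlgebraicClosure (RescaledCompletion K p w hw) ≃ₐ[ℚ_[p]] PadicAlgCl p)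
    (hconj : letI : Algebra K (RescaledCompletion K p w hw) := inferInstanceAs (Algebra K (w.adicCompletion K))
      ∀ φ : D.PiLoc D.PiXarrow (localToGF F (RescaledCompletion K p w hw)
          (localEmb (K := K) (Fbar := Fbar) (AlgebraicClosure (RescaledCompletion K p w hw)))) ≃ₜ*
        D.PiLoc D.PiXarrow (localToGF F (RescaledCompletion K p w hw)
          (localEmb (K := K) (Fbar := Fbar) (AlgebraicClosure (RescaledCompletion K p w hw)))),
      ∃ τ : PadicAlgCl p ≃ₐ[ℚ_[p]] PadicAlgCl p,
        ∀ g : D.PiLoc D.PiXarrow (localToGF F (RescaledCompletion K p w hw)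
          (localEmb (K := K) (Fbar := Fbar) (AlgebraicClosure (RescaledCompletion K p w hw)))),
        e.autCongr (AlgEquiv.restrictScalars ℚ_[p] (D.augLoc D.PiXarrow (localToGF F (RescaledCompletion K p w hw)
            (localEmb (K := K) (Fbar := Fbar) (AlgebraicClosure (RescaledCompletion K p w hw)))) (φ g))) =
          τ * e.autCongr (AlgEquiv.restrictScalars ℚ_[p] (D.augLoc D.PiXarrow (localToGF F (RescaledCompletion K p w hw)
            (localEmb (K := K) (Fbar := Fbar) (AlgebraicClosure (RescaledCompletion K p w hw)))) g)) * τ⁻¹) :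
    @GoodLocalFrobenioid.DdashFromD p (RescaledCompletion K p w hw) _
        (GaloisValDatum.normVal (RescaledCompletion K p w hw)) (D.goodLocalFrobenioidAt w p hw hX) ∧
      @GoodLocalFrobenioid.BasesFromC p (RescaledCompletion K p w hw) _
        (GaloisValDatum.normVal (RescaledCompletion K p w hw)) (D.goodLocalFrobenioidAt w p hw hX) ∧
      @GoodLocalFrobenioid.DFromF p (RescaledCompletion K p w hw) _
        (GaloisValDatum.normVal (RescaledCompletion K p w hw)) (D.goodLocalFrobenioidAt w p hw hX) ∧
      @GoodLocalFrobenioid.CdashFromF p (RescaledCompletion K p w hw) _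
        (GaloisValDatum.normVal (RescaledCompletion K p w hw)) (D.goodLocalFrobenioidAt w p hw hX) ∧
      @GoodLocalFrobenioid.SplitFromF p (RescaledCompletion K p w hw) _
        (GaloisValDatum.normVal (RescaledCompletion K p w hw)) (D.goodLocalFrobenioidAt w p hw hX) :=
  have h := D.ex33iii_abcd_goodLocalFrobenioidAt w p hw hX hΔC hΔ
  ⟨h.1, h.2.1, h.2.2.1, h.2.2.2, D.splitFromF_goodLocalFrobenioidAt_of_conj_autCongr w p hw hX hΔC hΔ e hconj⟩

/-- **Ex. 3.3 (iii) (a)–(e) jointly at the place, the Galois-countability instance supplied by FACT F-0240 `GeomTFG`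
BY NAME**: binders exactly {F-0240, `hX`, F-0004 (first conjunct), F-0007 (shape `hΔ`), DATA `e`, `hconj`
(G-L5t16g8-1)}. ([IUTchI] Ex 3.3 (iii) p.79) [claim: Mochizuki2012, status: disputed] -/
theorem ex33iii_goodLocalFrobenioidAt_of_conj_autCongr_of_geomTFG (hTFG : D.geom.extF.GeomTFG)
    (hX : IsOpen (D.PiXarrow : Set D.PiC)) (hΔC : IsSlimGroup D.DeltaC)
    (hΔ : letI : Algebra K (RescaledCompletion K p w hw) := inferInstanceAs (Algebra K (w.adicCompletion K))
      ∀ φ : D.PiLoc D.PiXarrow (localToGF F (RescaledCompletion K p w hw)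
          (localEmb (K := K) (Fbar := Fbar) (AlgebraicClosure (RescaledCompletion K p w hw)))) ≃ₜ*
        D.PiLoc D.PiXarrow (localToGF F (RescaledCompletion K p w hw)
          (localEmb (K := K) (Fbar := Fbar) (AlgebraicClosure (RescaledCompletion K p w hw)))),
      (D.augLoc D.PiXarrow (localToGF F (RescaledCompletion K p w hw)
          (localEmb (K := K) (Fbar := Fbar) (AlgebraicClosure (RescaledCompletion K p w hw))))).ker.map
          φ.toMulEquiv.toMonoidHom =
        (D.augLoc D.PiXarrow (localToGF F (RescaledCompletion K p w hw)
          (localEmb (K := K) (Fbar := Fbar) (AlgebraicClosure (RescaledCompletion K p w hw))))).ker)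
    (e : letI : Algebra K (RescaledCompletion K p w hw) := inferInstanceAs (Algebra K (w.adicCompletion K))
      AlgebraicClosure (RescaledCompletion K p w hw) ≃ₐ[ℚ_[p]] PadicAlgCl p)
    (hconj : letI : Algebra K (RescaledCompletion K p w hw) := inferInstanceAs (Algebra K (w.adicCompletion K))
      ∀ φ : D.PiLoc D.PiXarrow (localToGF F (RescaledCompletion K p w hw)
          (localEmb (K := K) (Fbar := Fbar) (AlgebraicClosure (RescaledCompletion K p w hw)))) ≃ₜ*
        D.PiLoc D.PiXarrow (localToGF F (RescaledCompletion K p w hw)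
          (localEmb (K := K) (Fbar := Fbar) (AlgebraicClosure (RescaledCompletion K p w hw)))),
      ∃ τ : PadicAlgCl p ≃ₐ[ℚ_[p]] PadicAlgCl p,
        ∀ g : D.PiLoc D.PiXarrow (localToGF F (RescaledCompletion K p w hw)
          (localEmb (K := K) (Fbar := Fbar) (AlgebraicClosure (RescaledCompletion K p w hw)))),
        e.autCongr (AlgEquiv.restrictScalars ℚ_[p] (D.augLoc D.PiXarrow (localToGF F (RescaledCompletion K p w hw)
            (localEmb (K := K) (Fbar := Fbar) (AlgebraicClosure (RescaledCompletion K p w hw)))) (φ g))) =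
          τ * e.autCongr (AlgEquiv.restrictScalars ℚ_[p] (D.augLoc D.PiXarrow (localToGF F (RescaledCompletion K p w hw)
            (localEmb (K := K) (Fbar := Fbar) (AlgebraicClosure (RescaledCompletion K p w hw)))) g)) * τ⁻¹) :
    @GoodLocalFrobenioid.DdashFromD p (RescaledCompletion K p w hw) _
        (GaloisValDatum.normVal (RescaledCompletion K p w hw)) (D.goodLocalFrobenioidAt w p hw hX) ∧
      @GoodLocalFrobenioid.BasesFromC p (RescaledCompletion K p w hw) _
        (GaloisValDatum.normVal (RescaledCompletion K p w hw)) (D.goodLocalFrobenioidAt w p hw hX) ∧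
      @GoodLocalFrobenioid.DFromF p (RescaledCompletion K p w hw) _
        (GaloisValDatum.normVal (RescaledCompletion K p w hw)) (D.goodLocalFrobenioidAt w p hw hX) ∧
      @GoodLocalFrobenioid.CdashFromF p (RescaledCompletion K p w hw) _
        (GaloisValDatum.normVal (RescaledCompletion K p w hw)) (D.goodLocalFrobenioidAt w p hw hX) ∧
      @GoodLocalFrobenioid.SplitFromF p (RescaledCompletion K p w hw) _
        (GaloisValDatum.normVal (RescaledCompletion K p w hw)) (D.goodLocalFrobenioidAt w p hw hX) :=
  haveI := D.secondCountableTopology_PiC_of_geomTFG hTFG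
  D.ex33iii_goodLocalFrobenioidAt_of_conj_autCongr w p hw hX hΔC hΔ e hconj

/-- **Ex. 3.3 (iii) (a)–(e) jointly at the place with [AbsAnab] Lemma 1.3.8 REPLACED by print's regime input** F-0001
`CoinvariantRankConstant` (unfolded shape at `Π_v̲`, [AbsTopI] Thm. 2.6 (ii)); binders exactly {F-0240, `hX`, F-0004
(first conjunct), F-0001 shape, DATA `e`, `hconj` (G-L5t16g8-1)}. ([IUTchI] Ex 3.3 (iii) p.79)
[claim: Mochizuki2012, status: disputed] -/
theorem ex33iii_goodLocalFrobenioidAt_of_conj_autCongr_of_coinvariantRank (hTFG : D.geom.extF.GeomTFG)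
    (hX : IsOpen (D.PiXarrow : Set D.PiC)) (hΔC : IsSlimGroup D.DeltaC)
    (hc : letI : Algebra K (RescaledCompletion K p w hw) := inferInstanceAs (Algebra K (w.adicCompletion K))
      ∀ P : Subgroup (D.PiLoc D.PiXarrow (localToGF F (RescaledCompletion K p w hw)
          (localEmb (K := K) (Fbar := Fbar) (AlgebraicClosure (RescaledCompletion K p w hw))))),
      IsOpen (P : Set (D.PiLoc D.PiXarrow (localToGF F (RescaledCompletion K p w hw)
          (localEmb (K := K) (Fbar := Fbar) (AlgebraicClosure (RescaledCompletion K p w hw)))))) →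
      ∀ (l₁ l₂ : ℕ) [Fact l₁.Prime] [Fact l₂.Prime],
        freeProlRank P l₁ - freeProlRank (P.map (D.augLoc D.PiXarrow (localToGF F (RescaledCompletion K p w hw)
          (localEmb (K := K) (Fbar := Fbar) (AlgebraicClosure (RescaledCompletion K p w hw)))))) l₁ =
          freeProlRank P l₂ - freeProlRank (P.map (D.augLoc D.PiXarrow (localToGF F (RescaledCompletion K p w hw)
            (localEmb (K := K) (Fbar := Fbar) (AlgebraicClosure (RescaledCompletion K p w hw)))))) l₂)
    (e : letI : Algebra K (RescaledCompletion K p w hw) := inferInstanceAs (Algebra K (w.adicCompletion K))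
      AlgebraicClosure (RescaledCompletion K p w hw) ≃ₐ[ℚ_[p]] PadicAlgCl p)
    (hconj : letI : Algebra K (RescaledCompletion K p w hw) := inferInstanceAs (Algebra K (w.adicCompletion K))
      ∀ φ : D.PiLoc D.PiXarrow (localToGF F (RescaledCompletion K p w hw)
          (localEmb (K := K) (Fbar := Fbar) (AlgebraicClosure (RescaledCompletion K p w hw)))) ≃ₜ*
        D.PiLoc D.PiXarrow (localToGF F (RescaledCompletion K p w hw)
          (localEmb (K := K) (Fbar := Fbar) (AlgebraicClosure (RescaledCompletion K p w hw)))),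
      ∃ τ : PadicAlgCl p ≃ₐ[ℚ_[p]] PadicAlgCl p,
        ∀ g : D.PiLoc D.PiXarrow (localToGF F (RescaledCompletion K p w hw)
          (localEmb (K := K) (Fbar := Fbar) (AlgebraicClosure (RescaledCompletion K p w hw)))),
        e.autCongr (AlgEquiv.restrictScalars ℚ_[p] (D.augLoc D.PiXarrow (localToGF F (RescaledCompletion K p w hw)
            (localEmb (K := K) (Fbar := Fbar) (AlgebraicClosure (RescaledCompletion K p w hw)))) (φ g))) =
          τ * e.autCongr (AlgEquiv.restrictScalars ℚ_[p] (D.augLoc D.PiXarrow (localToGF F (RescaledCompletion K p w hw)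
            (localEmb (K := K) (Fbar := Fbar) (AlgebraicClosure (RescaledCompletion K p w hw)))) g)) * τ⁻¹) :
    @GoodLocalFrobenioid.DdashFromD p (RescaledCompletion K p w hw) _
        (GaloisValDatum.normVal (RescaledCompletion K p w hw)) (D.goodLocalFrobenioidAt w p hw hX) ∧
      @GoodLocalFrobenioid.BasesFromC p (RescaledCompletion K p w hw) _
        (GaloisValDatum.normVal (RescaledCompletion K p w hw)) (D.goodLocalFrobenioidAt w p hw hX) ∧
      @GoodLocalFrobenioid.DFromF p (RescaledCompletion K p w hw) _
        (GaloisValDatum.normVal (RescaledCompletion K p w hw)) (D.goodLocalFrobenioidAt w p hw hX) ∧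
      @GoodLocalFrobenioid.CdashFromF p (RescaledCompletion K p w hw) _
        (GaloisValDatum.normVal (RescaledCompletion K p w hw)) (D.goodLocalFrobenioidAt w p hw hX) ∧
      @GoodLocalFrobenioid.SplitFromF p (RescaledCompletion K p w hw) _
        (GaloisValDatum.normVal (RescaledCompletion K p w hw)) (D.goodLocalFrobenioidAt w p hw hX) := by
  letI : Algebra K (RescaledCompletion K p w hw) := inferInstanceAs (Algebra K (w.adicCompletion K))
  haveI := GaloisValDatum.finiteDimensional_rescaledCompletion K p w hw
  exact D.ex33iii_goodLocalFrobenioidAt_of_conj_autCongr_of_geomTFG w p hw hTFG hX hΔC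
    (D.forall_map_ker_augLoc_of_coinvariantRank p (RescaledCompletion K p w hw)
      (localEmb (K := K) (Fbar := Fbar) (AlgebraicClosure (RescaledCompletion K p w hw))) hTFG hX hc) e hconj

/-! ### The genuine-place twin of `GoodLocalFrobenioid.exists_ex33Claims` -/

/-- **The interface `GoodLocalFrobenioid p K_v̲` over the ACTUAL completion `K_v̲ = K_w` is inhabited TOGETHER WITH all
five Ex. 3.3 (iii) clauses** (modulo the displayed binders of `ex33iii_goodLocalFrobenioidAt_of_conj_autCongr`), the
witness being the initial Θ-datum's own `goodLocalFrobenioidAt w p hw hX` — the data of Ex. 3.3 (i), (ii) at the place.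
Genuine-place twin of abc-iut-L5-t2's toy certificate `GoodLocalFrobenioid.exists_ex33Claims` (`K_v := ℚ_p`).
([IUTchI] Ex 3.3 (i)–(iii) pp.77–79) [claim: Mochizuki2012, status: disputed] -/
theorem exists_ex33Claims_at_place [SecondCountableTopology D.PiC]
    (hX : IsOpen (D.PiXarrow : Set D.PiC)) (hΔC : IsSlimGroup D.DeltaC)
    (hΔ : letI : Algebra K (RescaledCompletion K p w hw) := inferInstanceAs (Algebra K (w.adicCompletion K))
      ∀ φ : D.PiLoc D.PiXarrow (localToGF F (RescaledCompletion K p w hw)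
          (localEmb (K := K) (Fbar := Fbar) (AlgebraicClosure (RescaledCompletion K p w hw)))) ≃ₜ*
        D.PiLoc D.PiXarrow (localToGF F (RescaledCompletion K p w hw)
          (localEmb (K := K) (Fbar := Fbar) (AlgebraicClosure (RescaledCompletion K p w hw)))),
      (D.augLoc D.PiXarrow (localToGF F (RescaledCompletion K p w hw)
          (localEmb (K := K) (Fbar := Fbar) (AlgebraicClosure (RescaledCompletion K p w hw))))).ker.map
          φ.toMulEquiv.toMonoidHom =
        (D.augLoc D.PiXarrow (localToGF F (RescaledCompletion K p w hw)
          (localEmb (K := K) (Fbar := Fbar) (AlgebraicClosure (RescaledCompletion K p w hw))))).ker)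
    (e : letI : Algebra K (RescaledCompletion K p w hw) := inferInstanceAs (Algebra K (w.adicCompletion K))
      AlgebraicClosure (RescaledCompletion K p w hw) ≃ₐ[ℚ_[p]] PadicAlgCl p)
    (hconj : letI : Algebra K (RescaledCompletion K p w hw) := inferInstanceAs (Algebra K (w.adicCompletion K))
      ∀ φ : D.PiLoc D.PiXarrow (localToGF F (RescaledCompletion K p w hw)
          (localEmb (K := K) (Fbar := Fbar) (AlgebraicClosure (RescaledCompletion K p w hw)))) ≃ₜ*
        D.PiLoc D.PiXarrow (localToGF F (RescaledCompletion K p w hw)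
          (localEmb (K := K) (Fbar := Fbar) (AlgebraicClosure (RescaledCompletion K p w hw)))),
      ∃ τ : PadicAlgCl p ≃ₐ[ℚ_[p]] PadicAlgCl p,
        ∀ g : D.PiLoc D.PiXarrow (localToGF F (RescaledCompletion K p w hw)
          (localEmb (K := K) (Fbar := Fbar) (AlgebraicClosure (RescaledCompletion K p w hw)))),
        e.autCongr (AlgEquiv.restrictScalars ℚ_[p] (D.augLoc D.PiXarrow (localToGF F (RescaledCompletion K p w hw)
            (localEmb (K := K) (Fbar := Fbar) (AlgebraicClosure (RescaledCompletion K p w hw)))) (φ g))) =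
          τ * e.autCongr (AlgEquiv.restrictScalars ℚ_[p] (D.augLoc D.PiXarrow (localToGF F (RescaledCompletion K p w hw)
            (localEmb (K := K) (Fbar := Fbar) (AlgebraicClosure (RescaledCompletion K p w hw)))) g)) * τ⁻¹) :
    ∃ G : @GoodLocalFrobenioid.{0} p (RescaledCompletion K p w hw) _
        (GaloisValDatum.normVal (RescaledCompletion K p w hw)),
      @GoodLocalFrobenioid.DdashFromD p (RescaledCompletion K p w hw) _
          (GaloisValDatum.normVal (RescaledCompletion K p w hw)) G ∧
        @GoodLocalFrobenioid.BasesFromC p (RescaledCompletion K p w hw) _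
          (GaloisValDatum.normVal (RescaledCompletion K p w hw)) G ∧
        @GoodLocalFrobenioid.DFromF p (RescaledCompletion K p w hw) _
          (GaloisValDatum.normVal (RescaledCompletion K p w hw)) G ∧
        @GoodLocalFrobenioid.CdashFromF p (RescaledCompletion K p w hw) _
          (GaloisValDatum.normVal (RescaledCompletion K p w hw)) G ∧
        @GoodLocalFrobenioid.SplitFromF p (RescaledCompletion K p w hw) _
          (GaloisValDatum.normVal (RescaledCompletion K p w hw)) G :=
  ⟨D.goodLocalFrobenioidAt w p hw hX, D.ex33iii_goodLocalFrobenioidAt_of_conj_autCongr w p hw hX hΔC hΔ e hconj⟩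

/-- **The genuine-place twin of `exists_ex33Claims`, Galois-countability from FACT F-0240 `GeomTFG` BY NAME**:
binders exactly {F-0240, `hX`, F-0004 (first conjunct), F-0007 (shape `hΔ`), DATA `e`, `hconj` (G-L5t16g8-1)}.
([IUTchI] Ex 3.3 (i)–(iii) pp.77–79) [claim: Mochizuki2012, status: disputed] -/
theorem exists_ex33Claims_at_place_of_geomTFG (hTFG : D.geom.extF.GeomTFG)
    (hX : IsOpen (D.PiXarrow : Set D.PiC)) (hΔC : IsSlimGroup D.DeltaC)
    (hΔ : letI : Algebra K (RescaledCompletion K p w hw) := inferInstanceAs (Algebra K (w.adicCompletion K))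
      ∀ φ : D.PiLoc D.PiXarrow (localToGF F (RescaledCompletion K p w hw)
          (localEmb (K := K) (Fbar := Fbar) (AlgebraicClosure (RescaledCompletion K p w hw)))) ≃ₜ*
        D.PiLoc D.PiXarrow (localToGF F (RescaledCompletion K p w hw)
          (localEmb (K := K) (Fbar := Fbar) (AlgebraicClosure (RescaledCompletion K p w hw)))),
      (D.augLoc D.PiXarrow (localToGF F (RescaledCompletion K p w hw)
          (localEmb (K := K) (Fbar := Fbar) (AlgebraicClosure (RescaledCompletion K p w hw))))).ker.map
          φ.toMulEquiv.toMonoidHom =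
        (D.augLoc D.PiXarrow (localToGF F (RescaledCompletion K p w hw)
          (localEmb (K := K) (Fbar := Fbar) (AlgebraicClosure (RescaledCompletion K p w hw))))).ker)
    (e : letI : Algebra K (RescaledCompletion K p w hw) := inferInstanceAs (Algebra K (w.adicCompletion K))
      AlgebraicClosure (RescaledCompletion K p w hw) ≃ₐ[ℚ_[p]] PadicAlgCl p)
    (hconj : letI : Algebra K (RescaledCompletion K p w hw) := inferInstanceAs (Algebra K (w.adicCompletion K))
      ∀ φ : D.PiLoc D.PiXarrow (localToGF F (RescaledCompletion K p w hw)
          (localEmb (K := K) (Fbar := Fbar) (AlgebraicClosure (RescaledCompletion K p w hw)))) ≃ₜ*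
        D.PiLoc D.PiXarrow (localToGF F (RescaledCompletion K p w hw)
          (localEmb (K := K) (Fbar := Fbar) (AlgebraicClosure (RescaledCompletion K p w hw)))),
      ∃ τ : PadicAlgCl p ≃ₐ[ℚ_[p]] PadicAlgCl p,
        ∀ g : D.PiLoc D.PiXarrow (localToGF F (RescaledCompletion K p w hw)
          (localEmb (K := K) (Fbar := Fbar) (AlgebraicClosure (RescaledCompletion K p w hw)))),
        e.autCongr (AlgEquiv.restrictScalars ℚ_[p] (D.augLoc D.PiXarrow (localToGF F (RescaledCompletion K p w hw)
            (localEmb (K := K) (Fbar := Fbar) (AlgebraicClosure (RescaledCompletion K p w hw)))) (φ g))) =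
          τ * e.autCongr (AlgEquiv.restrictScalars ℚ_[p] (D.augLoc D.PiXarrow (localToGF F (RescaledCompletion K p w hw)
            (localEmb (K := K) (Fbar := Fbar) (AlgebraicClosure (RescaledCompletion K p w hw)))) g)) * τ⁻¹) :
    ∃ G : @GoodLocalFrobenioid.{0} p (RescaledCompletion K p w hw) _
        (GaloisValDatum.normVal (RescaledCompletion K p w hw)),
      @GoodLocalFrobenioid.DdashFromD p (RescaledCompletion K p w hw) _
          (GaloisValDatum.normVal (RescaledCompletion K p w hw)) G ∧
        @GoodLocalFrobenioid.BasesFromC p (RescaledCompletion K p w hw) _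
          (GaloisValDatum.normVal (RescaledCompletion K p w hw)) G ∧
        @GoodLocalFrobenioid.DFromF p (RescaledCompletion K p w hw) _
          (GaloisValDatum.normVal (RescaledCompletion K p w hw)) G ∧
        @GoodLocalFrobenioid.CdashFromF p (RescaledCompletion K p w hw) _
          (GaloisValDatum.normVal (RescaledCompletion K p w hw)) G ∧
        @GoodLocalFrobenioid.SplitFromF p (RescaledCompletion K p w hw) _
          (GaloisValDatum.normVal (RescaledCompletion K p w hw)) G :=
  haveI := D.secondCountableTopology_PiC_of_geomTFG hTFG
  D.exists_ex33Claims_at_place w p hw hX hΔC hΔ e hconj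

end InitialThetaData

end Place

end Literature.IUT.HodgeTheaters

end
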